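import Summits.HodgeConjecture.HodgeConjecture.Theorems.LimitExtensionDivisorInduction
import Summits.HodgeConjecture.HodgeConjecture.Theses.GenericDivisibility

/-!
# `DivisorInduction` (stmt-HodgeConjecture-18851), route `GenericDivisibility` — unconditional

The support item `DivisorInduction` of route `GenericDivisibility` re-asks, with the shared signature
verbatim, the divisor-induction step of the dimension induction (stmt-HodgeConjecture-1082, shared by
the routes `NodalSupport`, `LinearSystemTorelli`, `LimitExtension`): for `1 ≤ p`, if rational
`(p-1,p-1)`-classes are algebraic on smooth projective `n`-folds, then on a smooth projective
`(n+1)`-fold every rational `(p,p)`-class of coniveau `≥ 1` (`supportedClasses X (2p) 1`) is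
algebraic (Deligne, Hodge III, Prop. 8.2.7 / Cor. 8.2.8 + semisimplicity + push-forward; Thomas 2005
§2).

The proposition is definitionally the one already proved in the tree as
`Summit.HodgeConjecture.HodgeConjecture.Theorems.limitExtension_divisorInduction_proof`
(file `Theorems/LimitExtensionDivisorInduction`, which applies `divisorInduction_of_deligne827snc`
to the theorem `Literature.AlgebraicGeometry.HodgeTheory.Deligne1974_ker_pullback_eq_ker_pullback_snc_holds`);
this file transfers it to the `GenericDivisibility` decl literally. No definitions, no named-fact
hypotheses, no sorry. The route file itself deliberately imports nothing but the Statement and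
`CohomologyRingChange` (route-repair 2026-08-17, cone guardrail); the proof-carrying imports live
here, on the Theorems side, as intended.
-/

-- `Summit.HodgeConjecture.HodgeConjecture.Theorems` is the mandated namespace (single-conjunct summit:
-- Sub = Summit), which `linter.dupNamespace` flags; off tree-wide in the lakefile, restated here so
-- stand-alone elaboration is warning-free too.
set_option linter.dupNamespace false

noncomputable section

namespace Summit.HodgeConjecture.HodgeConjecture.Theorems

/-- **`DivisorInduction` (stmt-HodgeConjecture-18851), route `GenericDivisibility` decl,
unconditionally.** For `1 ≤ p`: if rational `(p-1,p-1)`-classes are algebraic on every smooth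
projective `n`-fold, then on every smooth projective `(n+1)`-fold a rational `(p,p)`-class supported
in codimension `≥ 1` is algebraic. Proof: the decl unfolds to the shared signature of
stmt-HodgeConjecture-1082, proved by `limitExtension_divisorInduction_proof` (log resolution of the
support to an snc boundary, Deligne's Gysin-kernel statement Hodge III Prop. 8.2.7 for snc boundaries
by the principle of two types, Voisin's lift of Hodge classes along the Gysin surjection, the
codimension-`(p-1)` hypothesis on the components, push-forward).
[cite: DeligneHodgeIII1974, Prop. 8.2.7 and Cor. 8.2.8 (p. 40)] [cite: Thomas2005Nodes, §2] -/
theorem genericDivisibility_divisorInduction_proof :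
    Summit.HodgeConjecture.HodgeConjecture.Theses.GenericDivisibility.DivisorInduction := by
  unfold Summit.HodgeConjecture.HodgeConjecture.Theses.GenericDivisibility.DivisorInduction
  exact limitExtension_divisorInduction_proof

end Summit.HodgeConjecture.HodgeConjecture.Theorems

end
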